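import Summits.ABC.ABC.Theorems.DefiniteXiDefiniteRTControlPrimeValTransport
import Summits.ABC.ABC.Theorems.IsogenyGlueCongruenceKenkuPrintedLevelsOfThreeLevels
import Literature.NumberTheory.EllipticCurves.PastenHeightBoundsLemma68LocalProofs
import Literature.NumberTheory.EllipticCurves.MazurTorsionPrimeCaseFromCor44Proofs
import HarnessLib

/-!
# Stub ideas k3 (gen 2) for `stub_pastenLemma68 : PastenShimura2024_lemma_6_8` — FAMILY 3, the extremes

Helper signatures + cheap assemblies for the plan `STUB-IDEAS-stub_pastenLemma68-3.md` (crux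
`DefiniteRTControlPrime`, stmt-ABC-11338).  `lean check` rc 0; exactly FOUR `sorry`s — H4a
`compositeRows_valuation_le_one` (S), H7 `freyCurve_geomTorsion_two_fixed` (S–M), H5
`exists_isCyclic_degree_two_mul_of_twoTorsion` (M), H6 `exists_isCyclic_degree_four_mul_of_fullTwoTorsion`
(M); everything else (H0, H1 = Cor. 4.4 ⇒ odd prime support incl. H1a/H1b, the generic pointwise
radius H2, the two `decide`-checked covers H3, H4b, H8, all exclusions, Plans A/B/C, the Frey radius
and the reshape certificate `valTransport_of_lemma68FreyOdd`) is a real proof.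
-/

set_option linter.dupNamespace false
set_option linter.unusedVariables false

noncomputable section

open scoped Classical
open WeierstrassCurve IsDedekindDomain NumberField
open Literature.NumberTheory.EllipticCurves Literature.NumberTheory.EllipticCurves.ModularForms
open Summit.ABC.ABC.Theorems

namespace Summit.ABC.ABC.Cruxes.DefiniteRTControlPrime.StubIdeas3G2

/-! ## 0. The two re-cut targets (slices of the verbatim stub) -/

/-- Lemma 6.8 at ODD places only. -/
def Lemma68Odd : Prop :=
  ∀ (W W' : WeierstrassCurve ℚ) [W.IsElliptic] [W'.IsElliptic], W.IsIsogenous W' →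
    ∀ v : HeightOneSpectrum ℤ, Rat.HeightOneSpectrum.natGenerator v ≠ 2 →
      W.HasMultiplicativeReductionAt v →
        ∃ m n : ℕ, 0 < m ∧ m ≤ 163 ∧ 0 < n ∧ n ≤ 163 ∧
          W.ordMinimalDiscriminant v * n = W'.ordMinimalDiscriminant v * m

/-- Lemma 6.8 at a FREY source and an ODD place — literally the instance `stub_valTransport` consumes. -/
def Lemma68FreyOdd : Prop :=
  ∀ (a b : ℤ), IsCoprime a b → a * b * (a + b) ≠ 0 →
    ∀ (W' : WeierstrassCurve ℚ) [W'.IsElliptic], (freyCurve a b).IsIsogenous W' →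
      ∀ v : HeightOneSpectrum ℤ, Rat.HeightOneSpectrum.natGenerator v ≠ 2 →
        (freyCurve a b).HasMultiplicativeReductionAt v →
          ∃ m n : ℕ, 0 < m ∧ m ≤ 163 ∧ 0 < n ∧ n ≤ 163 ∧
            (freyCurve a b).ordMinimalDiscriminant v * n = W'.ordMinimalDiscriminant v * m

theorem lemma68Odd_of_lemma68 (h : PastenShimura2024_lemma_6_8) : Lemma68Odd :=
  fun W W' _ _ hiso v _ hv ↦ h W W' hiso v hv

theorem lemma68FreyOdd_of_lemma68Odd (h : Lemma68Odd) : Lemma68FreyOdd := by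
  intro a b hab h0 W' _ hiso v hv2 hv
  haveI := isElliptic_freyCurve h0
  exact h (freyCurve a b) W' hiso v hv2 hv

/-! ## 1. Pointwise: an isogeny of degree `≤ 163` gives Lemma 6.8 at `(W, W', v)` (H0, proved) -/

/-- (H0) Lemma 6.8 at one triple from ONE isogeny `W → W'` of degree `≤ 163` (not necessarily cyclic). -/
theorem lemma68At_of_degree_le {W W' : WeierstrassCurve ℚ} [W.IsElliptic] [W'.IsElliptic]
    (φ : Isogeny W W') (hφ : φ.degree ≤ 163) (v : HeightOneSpectrum ℤ)
    (hv : W.HasMultiplicativeReductionAt v) :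
    ∃ m n : ℕ, 0 < m ∧ m ≤ 163 ∧ 0 < n ∧ n ≤ 163 ∧
      W.ordMinimalDiscriminant v * n = W'.ordMinimalDiscriminant v * m := by
  have hv' : W'.HasMultiplicativeReductionAt v := hasMultiplicativeReductionAt_of_isIsogenous ⟨φ⟩ v hv
  obtain ⟨ψ, hψ, hdvd⟩ := φ.exists_isCyclic_degree_dvd
  obtain ⟨a, b, ha, hb, hab, h⟩ :=
    exists_ordMinimalDiscriminant_mul_eq_mul_of_isCyclic ψ.degree ψ hψ rfl v hv hv'
  have hψle : ψ.degree ≤ 163 := (Nat.le_of_dvd φ.degree_pos hdvd).trans hφ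
  have hab' : a * b ≤ 163 := (Nat.le_of_dvd ψ.degree_pos hab).trans hψle
  refine ⟨a, b, ha, ?_, hb, ?_, h⟩ <;> nlinarith

/-! ## 2. Generic pointwise radius from prime support + covering barrier (H2, proved) -/

/-- Elementary (copy of the private `exists_dvd_gt_le_sq` of `…MazurKenkuBoundStubRadius`). -/
theorem exists_dvd_gt_le_sq' {n : ℕ} (hn : 163 < n)
    (hp : ∀ p : ℕ, p.Prime → p ∣ n → p ≤ 163) :
    ∃ d, d ∣ n ∧ 163 < d ∧ d ≤ 163 * 163 := by
  have hex : ∃ e, e ∣ n ∧ 163 < e := ⟨n, dvd_rfl, hn⟩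
  refine ⟨Nat.find hex, (Nat.find_spec hex).1, (Nat.find_spec hex).2, ?_⟩
  by_contra hgt
  rw [not_le] at hgt
  obtain ⟨hdn, hd⟩ := Nat.find_spec hex
  obtain ⟨p, hpp, hpd⟩ := Nat.exists_prime_and_dvd (show Nat.find hex ≠ 1 by omega)
  have hple : p ≤ 163 := hp p hpp (hpd.trans hdn)
  obtain ⟨m, hm⟩ := hpd
  have hmd : m ∣ Nat.find hex := Dvd.intro_left p hm.symm
  have hm163 : 163 < m := by
    by_contra hmle
    have := Nat.mul_le_mul hple (not_lt.mp hmle)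
    omega
  have hmlt : m < Nat.find hex := by
    rw [hm]
    exact lt_mul_of_one_lt_left (by omega) hpp.one_lt
  exact Nat.find_min hex hmlt ⟨hmd.trans hdn, hm163⟩

/-- (H2) **Pointwise radius, generic in the support `S` and the barrier `B`.** For a FIXED source `W`:
if every prime dividing the degree of a cyclic `ℚ`-isogeny out of `W` lies in `S ⊆ [1,163]`, every
`S`-smooth `d ∈ (163, 163²]` has a divisor in `B`, and no cyclic isogeny out of `W` has degree in
`B`, then every curve `ℚ`-isogenous to `W` is reached from `W` by an isogeny of degree `≤ 163`. -/
theorem radius_at_of_support_of_barrier (S B : Finset ℕ) (hS : ∀ p ∈ S, p ≤ 163)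
    (hcov : ∀ d ∈ Finset.Ioc 163 (163 * 163), (∀ p ∈ d.primeFactors, p ∈ S) → ∃ b ∈ B, b ∣ d)
    {W : WeierstrassCurve ℚ} [W.IsElliptic]
    (hsupp : ∀ (W'' : WeierstrassCurve ℚ) [W''.IsElliptic] (φ : Isogeny W W''), φ.IsCyclic →
      ∀ p : ℕ, p.Prime → p ∣ φ.degree → p ∈ S)
    (hexcl : ∀ (W'' : WeierstrassCurve ℚ) [W''.IsElliptic] (φ : Isogeny W W''), φ.IsCyclic →
      φ.degree ∉ B)
    {W' : WeierstrassCurve ℚ} [W'.IsElliptic] (hiso : W.IsIsogenous W') :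
    ∃ φ : Isogeny W W', φ.degree ≤ 163 := by
  obtain ⟨ψ, hψ⟩ := hiso.exists_isCyclic
  refine ⟨ψ, ?_⟩
  by_contra hlt
  rw [not_le] at hlt
  have hprime : ∀ p : ℕ, p.Prime → p ∣ ψ.degree → p ∈ S := fun p hp hpd ↦ hsupp W' ψ hψ p hp hpd
  obtain ⟨d₁, hd₁n, hlt₁, hle₁⟩ :=
    exists_dvd_gt_le_sq' hlt fun p hp hpd ↦ hS p (hprime p hp hpd)
  have hd₁S : ∀ p ∈ d₁.primeFactors, p ∈ S := fun p hp ↦ by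
    obtain ⟨hpp, hpd, -⟩ := Nat.mem_primeFactors.mp hp
    exact hprime p hpp (hpd.trans hd₁n)
  obtain ⟨b, hbB, hbd⟩ := hcov d₁ (Finset.mem_Ioc.mpr ⟨hlt₁, hle₁⟩) hd₁S
  obtain ⟨W'', hW'', χ, hχ, hχd, -⟩ := ψ.exists_isCyclic_degree_eq_of_dvd hψ (hbd.trans hd₁n)
  haveI := hW''
  exact hexcl W'' χ hχ (hχd ▸ hbB)

/-! ## 3. The two barrier covers (H3F, H3O: finite checks, proved by `decide +kernel`) -/

/-- Core check, Frey slice: every `d ∈ (163, 163²]` dividing `42¹⁵` has a divisor in `{21,27,32,49}`. -/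
theorem freyBarrier_covers_core :
    ∀ d ∈ Finset.Ioc 163 (163 * 163), 2232232135326160725639168 % d = 0 →
      ∃ b ∈ ({21, 27, 32, 49} : Finset ℕ), b ∣ d := by
  decide +kernel

theorem frey_pow_fifteen_dvd : ∀ p ∈ ({2, 3, 7} : Finset ℕ), p ^ 15 ∣ 2232232135326160725639168 := by
  decide +kernel

/-- Core check, odd slice: every `d ∈ (163, 163²]` dividing `2730¹⁵` has a divisor in `B_odd`. -/
theorem oddBarrier_covers_core :
    ∀ d ∈ Finset.Ioc 163 (163 * 163),
      3486901710858771471857936291044591857000000000000000 % d = 0 →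
      ∃ b ∈ ({15, 20, 21, 26, 27, 32, 35, 49, 65, 125, 169} : Finset ℕ), b ∣ d := by
  decide +kernel

theorem odd_pow_fifteen_dvd : ∀ p ∈ ({2, 3, 5, 7, 13} : Finset ℕ),
    p ^ 15 ∣ 3486901710858771471857936291044591857000000000000000 := by
  decide +kernel

/-- From the core check to the prime-factor form (the landed `lite_covers` argument, generic). -/
theorem covers_of_core (S B : Finset ℕ) (M : ℕ) (hM : ∀ p ∈ S, p ^ 15 ∣ M)
    (hcore : ∀ d ∈ Finset.Ioc 163 (163 * 163), M % d = 0 → ∃ b ∈ B, b ∣ d) :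
    ∀ d ∈ Finset.Ioc 163 (163 * 163), (∀ p ∈ d.primeFactors, p ∈ S) → ∃ b ∈ B, b ∣ d := by
  intro d hd hS
  refine hcore d hd (Nat.mod_eq_zero_of_dvd ?_)
  obtain ⟨hd163, hd26569⟩ := Finset.mem_Ioc.mp hd
  refine (Nat.dvd_iff_prime_pow_dvd_dvd _ _).mpr fun p k hp hpk => ?_
  rcases Nat.eq_zero_or_pos k with rfl | hk
  · exact (pow_zero p).symm ▸ one_dvd _
  have hpd : p ∣ d := (dvd_pow_self p hk.ne').trans hpk
  have hp_mem : p ∈ S := hS p (Nat.mem_primeFactors.mpr ⟨hp, hpd, by omega⟩)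
  have hk15 : k ≤ 15 := by
    have h1 : p ^ k ≤ d := Nat.le_of_dvd (by omega) hpk
    have h2 : 2 ^ k ≤ p ^ k := Nat.pow_le_pow_left hp.two_le k
    by_contra hk15
    have h3 : 2 ^ 16 ≤ 2 ^ k := Nat.pow_le_pow_right (by norm_num) (by omega)
    norm_num at h3
    omega
  exact (pow_dvd_pow p hk15).trans (hM p hp_mem)

/-- (H3F) The Frey barrier `{21, 27, 32, 49}` covers every `{2,3,7}`-smooth `d ∈ (163, 163²]`. -/
theorem freyBarrier_covers :
    ∀ d ∈ Finset.Ioc 163 (163 * 163), (∀ p ∈ d.primeFactors, p ∈ ({2, 3, 7} : Finset ℕ)) →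
      ∃ b ∈ ({21, 27, 32, 49} : Finset ℕ), b ∣ d :=
  covers_of_core _ _ _ frey_pow_fifteen_dvd freyBarrier_covers_core

/-- (H3O) The odd barrier covers every `{2,3,5,7,13}`-smooth `d ∈ (163, 163²]`. -/
theorem oddBarrier_covers :
    ∀ d ∈ Finset.Ioc 163 (163 * 163), (∀ p ∈ d.primeFactors, p ∈ ({2, 3, 5, 7, 13} : Finset ℕ)) →
      ∃ b ∈ ({15, 20, 21, 26, 27, 32, 35, 49, 65, 125, 169} : Finset ℕ), b ∣ d :=
  covers_of_core _ _ _ odd_pow_fifteen_dvd oddBarrier_covers_core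

/-! ## 4. Odd-place prime support from Mazur Cor. 4.4 ALONE (H1 proved from H1a, H1b) -/

/-- (H1a, PROVED) The `p`-part of a cyclic kernel is a `Γ_ℚ`-stable subgroup of `E[p]` of order `p`
(`Isogeny.natCard_ker_inf_geomTorsion_of_isCyclic` + `smul_mem_ker_inf_geomTorsion`, transported to
`AddSubgroup (geomTorsion W p)` along the subtype). -/
theorem exists_stable_natCard_eq_of_isCyclic_dvd {W W'' : WeierstrassCurve ℚ} [W.IsElliptic]
    [W''.IsElliptic] (φ : Isogeny W W'') (hφ : φ.IsCyclic) {p : ℕ} (hp : p.Prime)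
    (hpd : p ∣ φ.degree) :
    ∃ C : AddSubgroup (geomTorsion W (p : ℤ)),
      (∀ σ : Field.absoluteGaloisGroup ℚ, ∀ P ∈ C, σ • P ∈ C) ∧ Nat.card C = p := by
  set H := φ.toAddMonoidHom.ker ⊓ geomTorsion W (p : ℤ) with hH
  refine ⟨H.addSubgroupOf (geomTorsion W (p : ℤ)), ?_, ?_⟩
  · intro σ P hP
    rw [AddSubgroup.mem_addSubgroupOf] at hP ⊢
    exact φ.smul_mem_ker_inf_geomTorsion (p : ℤ) σ hP
  · rw [Nat.card_congr (AddSubgroup.addSubgroupOfEquivOfLe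
      (inf_le_right : H ≤ geomTorsion W (p : ℤ))).toEquiv]
    exact φ.natCard_ker_inf_geomTorsion_of_isCyclic hφ hpd

/-- (H1b, PROVED) The `ℤ`-place / `𝓞 ℚ`-place bridge for "`v(j) < 0` at an odd multiplicative place":
`conductorExponent_eq_one_iff_holds` + `conductorExponent_eq_of_primesEquiv_eq` transport
multiplicativity to the place of `𝓞 ℚ` over the same prime, then *AEC* VII.5.1(b)
(`one_lt_valuation_j_of_hasMultiplicativeReduction_localMinimalModel`); oddness by
`Mazur1978.two_not_mem_asIdeal_of_ne_two`. -/
theorem exists_oddPlace_one_lt_valuation_j {W : WeierstrassCurve ℚ} [W.IsElliptic]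
    {v : HeightOneSpectrum ℤ} (hv2 : Rat.HeightOneSpectrum.natGenerator v ≠ 2)
    (hv : W.HasMultiplicativeReductionAt v) :
    ∃ v' : HeightOneSpectrum (𝓞 ℚ), (2 : 𝓞 ℚ) ∉ v'.asIdeal ∧ 1 < v'.valuation ℚ W.j := by
  -- the place of `𝓞 ℚ` above the same prime (transport as in `hasMultiplicativeReductionAt_of_isIsogenous`)
  set v' : HeightOneSpectrum (𝓞 ℚ) :=
    (Rat.HeightOneSpectrum.primesEquiv (R := 𝓞 ℚ)).symm
      (Rat.HeightOneSpectrum.primesEquiv v) with hv'def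
  have hvv' : (Rat.HeightOneSpectrum.primesEquiv v : Nat.Primes) =
      Rat.HeightOneSpectrum.primesEquiv v' := by
    rw [hv'def, Equiv.apply_symm_apply]
  have h1 : W.conductorExponent v = 1 := (conductorExponent_eq_one_iff_holds v W).mpr hv
  rw [conductorExponent_eq_of_primesEquiv_eq v v' W hvv'] at h1
  have hW : W.HasMultiplicativeReductionAt v' := (conductorExponent_eq_one_iff_holds v' W).mp h1
  refine ⟨v', Mazur1978.two_not_mem_asIdeal_of_ne_two v' ?_,
    one_lt_valuation_j_of_hasMultiplicativeReduction_localMinimalModel v' W hW⟩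
  rw [← hvv']
  exact hv2

/-- (H1) **Prime support at an odd multiplicative place, from Cor. 4.4 alone** (no Thm 1, no
Prop. 5.1, no `j`-tables): a prime `p` dividing the degree of a cyclic `ℚ`-isogeny out of a curve
multiplicative at an odd place is one of `2, 3, 5, 7, 13` — for `p = 11` or `p ≥ 17`, Cor. 4.4 makes
`j` integral at every odd place, contradicting `v(j) < 0`. -/
theorem mem_oddSupport_of_cor44 (h44 : Mazur1978.cor44_valuation_j_le_one)
    {W W'' : WeierstrassCurve ℚ} [W.IsElliptic] [W''.IsElliptic] (φ : Isogeny W W'')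
    (hφ : φ.IsCyclic) {v : HeightOneSpectrum ℤ} (hv2 : Rat.HeightOneSpectrum.natGenerator v ≠ 2)
    (hv : W.HasMultiplicativeReductionAt v) {p : ℕ} (hp : p.Prime) (hpd : p ∣ φ.degree) :
    p ∈ ({2, 3, 5, 7, 13} : Finset ℕ) := by
  by_contra hnot
  haveI : Fact p.Prime := ⟨hp⟩
  obtain ⟨v', hv'2, hv'j⟩ := exists_oddPlace_one_lt_valuation_j hv2 hv
  exact absurd (h44 W p (Mazur1978.eq_eleven_or_seventeen_le_of_not_mem hp hnot)
    (exists_stable_natCard_eq_of_isCyclic_dvd φ hφ hp hpd) v' hv'2) (not_le.mpr hv'j)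

/-! ## 5. Exclusions at an odd multiplicative source (H4) -/

/-- The nine rows of Kenku's table at the composite levels `15, 21, 27` (verbatim the literal of
`KenkuCompositeTables`, stmt-ABC-18225, PROVED in the tree as `kenkuCompositeTables_proof`). -/
def compositeRows : Finset (ℕ × ℚ) :=
  {((15 : ℕ), (-25 / 2 : ℚ)), (15, -349938025 / 8), (15, -121945 / 32), (15, 46969655 / 32768),
    (21, -140625 / 8), (21, 3375 / 2), (21, -1159088625 / 2097152), (21, -189613868625 / 128),
    (27, -12288000)}

/-- (H4a, S) The nine tabulated `j`-values have `2`-power denominators (`2, 2³, 2⁵, 2¹⁵, 2³, 2,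
2²¹, 2⁷, 1`), hence are integral at every ODD place of `ℤ`: `v(z / 2^k) = v(z) ≤ 1` as `v(2) = 1`
for `v ∤ 2` (`HeightOneSpectrum.valuation_le_one` on `ℤ`, `valuation_eq_one` of a non-member). -/
theorem compositeRows_valuation_le_one (v : HeightOneSpectrum ℤ)
    (hv2 : Rat.HeightOneSpectrum.natGenerator v ≠ 2) :
    ∀ r ∈ compositeRows, v.valuation ℚ r.2 ≤ 1 := by
  sorry

/-- `v(j) < 0` at a multiplicative place of `ℤ` (AEC VII.5.1(b), the tree's
`one_lt_valuation_j_of_hasMultiplicativeReduction_localMinimalModel` at `A = ℤ`). (PROVED) -/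
theorem one_lt_valuation_j_at {W : WeierstrassCurve ℚ} [W.IsElliptic] (v : HeightOneSpectrum ℤ)
    (hv : W.HasMultiplicativeReductionAt v) : 1 < v.valuation ℚ W.j :=
  one_lt_valuation_j_of_hasMultiplicativeReduction_localMinimalModel v W hv

/-- (H4b, PROVED from H4a) Levels `15, 21, 27` are impossible for a cyclic isogeny OUT OF a curve
with an odd multiplicative place: the landed `kenkuCompositeTables_proof` puts `(deg, j)` in the nine
rows, whose `j` are integral at odd places (H4a), while `v(j) < 0`. -/
theorem isCyclic_degree_not_mem_oddTables {W W'' : WeierstrassCurve ℚ} [W.IsElliptic]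
    [W''.IsElliptic] (φ : Isogeny W W'') (hφ : φ.IsCyclic) {v : HeightOneSpectrum ℤ}
    (hv2 : Rat.HeightOneSpectrum.natGenerator v ≠ 2) (hv : W.HasMultiplicativeReductionAt v) :
    φ.degree ∉ ({15, 21, 27} : Finset ℕ) := by
  intro hmem
  have hrow : (φ.degree, W.j) ∈ compositeRows := kenkuCompositeTables_proof W W'' φ hφ hmem
  exact absurd (compositeRows_valuation_le_one v hv2 _ hrow) (not_le.mpr (one_lt_valuation_j_at v hv))

/-! ## 6. The Frey extras: rational `2`-torsion pushes `m ↦ 2m` and `m ↦ 4m` (H5, H6, H7) -/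

/-- (H7, S–M) The Frey curve `y² = x(x-a)(x+b)` has all of `E[2]` pointwise `Γ_ℚ`-fixed
(`freyCurve_two_torsion` + `Affine.Point.map` + `#E[2] = 4`). -/
theorem freyCurve_geomTorsion_two_fixed {a b : ℤ} (h0 : a * b * (a + b) ≠ 0) :
    haveI := isElliptic_freyCurve h0
    ∀ σ : Field.absoluteGaloisGroup ℚ, ∀ P ∈ geomTorsion (freyCurve a b) (2 : ℤ), σ • P = P := by
  sorry

/-- (H5, M) **`m ↦ 2m`.** A non-zero `Γ_ℚ`-fixed `2`-torsion point `Q` and a cyclic isogeny of odd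
degree `m` out of `W` give a cyclic isogeny of degree `2m` out of `W` (kernel `⟨Q⟩ ⊕ ker`, cyclic as
`gcd(2, m) = 1`; quotient by `exists_isogeny_ker_eq_and_comp_eq_nsmul_holds`). -/
theorem exists_isCyclic_degree_two_mul_of_twoTorsion {W : WeierstrassCurve ℚ} [W.IsElliptic]
    {Q : W.geomPoints} (hQ2 : Q ∈ geomTorsion W (2 : ℤ)) (hQ0 : Q ≠ 0)
    (hQfix : ∀ σ : Field.absoluteGaloisGroup ℚ, σ • Q = Q)
    {W' : WeierstrassCurve ℚ} [W'.IsElliptic] (ψ : Isogeny W W') (hψ : ψ.IsCyclic) {m : ℕ}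
    (hm : Odd m) (hdeg : ψ.degree = m) :
    ∃ (W₂ : WeierstrassCurve ℚ) (_ : W₂.IsElliptic) (χ : Isogeny W W₂),
      χ.IsCyclic ∧ χ.degree = 2 * m := by
  sorry

/-- (H6, L) **`m ↦ 4m` on the `2`-neighbour.** If ALL of `E[2]` is `Γ_ℚ`-fixed and `W` has a cyclic
isogeny of odd degree `m`, then the `2`-neighbour `W₁ = W/⟨Q₁⟩` carries a cyclic isogeny of degree
`4m`: kernel `ĝ⁻¹(⟨Q₂⟩ ⊕ ker ψ)` for the dual `ĝ : W₁ → W` of `g : W → W₁` (order `2·2m`; contains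
no `W₁[ℓ]`: for odd `ℓ` because `ĝ` embeds `W₁[ℓ]` onto `W[ℓ] ⊄ ker ψ`, for `ℓ = 2` because
`ĝ(W₁[2]) = ⟨Q₁⟩ ⊄ ⟨Q₂⟩ ⊕ (odd)`; cyclic by `exists_prime_geomTorsion_le_of_not_isAddCyclic`) — the
construction of `Isogeny.exists_isCyclic_ker_ne_of_degree_eq_prime_sq_mul` with `p = 2`. -/
theorem exists_isCyclic_degree_four_mul_of_fullTwoTorsion {W : WeierstrassCurve ℚ} [W.IsElliptic]
    (h2 : ∀ σ : Field.absoluteGaloisGroup ℚ, ∀ P ∈ geomTorsion W (2 : ℤ), σ • P = P)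
    {W' : WeierstrassCurve ℚ} [W'.IsElliptic] (ψ : Isogeny W W') (hψ : ψ.IsCyclic) {m : ℕ}
    (hm : Odd m) (hdeg : ψ.degree = m) :
    ∃ (W₁ : WeierstrassCurve ℚ) (_ : W₁.IsElliptic) (W₂ : WeierstrassCurve ℚ) (_ : W₂.IsElliptic)
      (χ : Isogeny W₁ W₂), W.IsIsogenous W₁ ∧ χ.IsCyclic ∧ χ.degree = 4 * m := by
  sorry

/-- A non-zero element of `E[2]` exists (`#E[2] = 4`, `natCard_geomTorsion_eq_sq`). (PROVED) -/
theorem exists_ne_zero_mem_geomTorsion_two (W : WeierstrassCurve ℚ) [W.IsElliptic] :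
    ∃ Q : W.geomPoints, Q ∈ geomTorsion W (2 : ℤ) ∧ Q ≠ 0 := by
  have hcard : Nat.card (geomTorsion W (2 : ℤ)) = 4 := by
    simpa using W.natCard_geomTorsion_eq_sq (n := 2) (by norm_num : ((2 : ℕ) : ℚ) ≠ 0)
  haveI : Finite (geomTorsion W (2 : ℤ)) := Nat.finite_of_card_ne_zero (by rw [hcard]; norm_num)
  haveI : Nontrivial (geomTorsion W (2 : ℤ)) :=
    Finite.one_lt_card_iff_nontrivial.mp (by rw [hcard]; norm_num)
  obtain ⟨Q, hQ⟩ := exists_ne (0 : geomTorsion W (2 : ℤ))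
  exact ⟨Q, Q.2, fun h ↦ hQ (Subtype.ext h)⟩

/-! ## 7. Frey prime support `{2, 3, 7}` (H8, proved from H1, H5, H6, H7 + landed levels 20, 26) -/

/-- (H8) For a Frey curve with an odd multiplicative place, every prime dividing the degree of a
cyclic `ℚ`-isogeny out of it is `2`, `3` or `7`: `11, ≥ 17` by Cor. 4.4 (H1); `13 ↦ 26` by H5 and
the landed level `26` (mod Klein–Fricke 13); `5 ↦ 20` on the `2`-neighbour by H6 and the landed
level `20`. -/
theorem frey_primeSupport (h44 : Mazur1978.cor44_valuation_j_le_one)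
    (h13 : kleinFrickeThirteen_exists_j_eq) {a b : ℤ} (h0 : a * b * (a + b) ≠ 0)
    {v : HeightOneSpectrum ℤ} (hv2 : Rat.HeightOneSpectrum.natGenerator v ≠ 2)
    (hv : (freyCurve a b).HasMultiplicativeReductionAt v) :
    haveI := isElliptic_freyCurve h0
    ∀ (W'' : WeierstrassCurve ℚ) [W''.IsElliptic] (φ : Isogeny (freyCurve a b) W''), φ.IsCyclic →
      ∀ p : ℕ, p.Prime → p ∣ φ.degree → p ∈ ({2, 3, 7} : Finset ℕ) := by
  haveI := isElliptic_freyCurve h0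
  intro W'' _ φ hφ p hp hpd
  have h5 := mem_oddSupport_of_cor44 h44 φ hφ hv2 hv hp hpd
  -- a cyclic isogeny of degree exactly `p` out of the Frey curve
  obtain ⟨Wp, hWp, ψ, hψ, hψd, -⟩ := φ.exists_isCyclic_degree_eq_of_dvd hφ hpd
  haveI := hWp
  have hne5 : p ≠ 5 := by
    rintro rfl
    obtain ⟨W₁, hW₁, W₂, hW₂, χ, -, hχ, hχd⟩ :=
      exists_isCyclic_degree_four_mul_of_fullTwoTorsion (freyCurve_geomTorsion_two_fixed h0) ψ hψ
        (by decide) hψd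
    haveI := hW₁; haveI := hW₂
    exact stub_levelTwenty W₁ W₂ χ hχ (by rw [hχd])
  have hne13 : p ≠ 13 := by
    rintro rfl
    obtain ⟨Q, hQ2, hQ0⟩ := exists_ne_zero_mem_geomTorsion_two (freyCurve a b)
    obtain ⟨W₂, hW₂, χ, hχ, hχd⟩ :=
      exists_isCyclic_degree_two_mul_of_twoTorsion hQ2 hQ0
        (fun σ ↦ freyCurve_geomTorsion_two_fixed h0 σ Q hQ2) ψ hψ (by decide) hψd
    haveI := hW₂
    exact isCyclic_degree_ne_twentySix h13 (freyCurve a b) W₂ χ hχ (by rw [hχd])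
  simp only [Finset.mem_insert, Finset.mem_singleton] at h5 ⊢
  omega

/-- Frey barrier exclusions `{21, 27, 32, 49}` at an odd multiplicative source: H4b + the landed
levels `32` and `49`. -/
theorem frey_barrier_excl {W : WeierstrassCurve ℚ} [W.IsElliptic] {v : HeightOneSpectrum ℤ}
    (hv2 : Rat.HeightOneSpectrum.natGenerator v ≠ 2) (hv : W.HasMultiplicativeReductionAt v)
    (W'' : WeierstrassCurve ℚ) [W''.IsElliptic] (φ : Isogeny W W'') (hφ : φ.IsCyclic) :
    φ.degree ∉ ({21, 27, 32, 49} : Finset ℕ) := by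
  intro hmem
  have hsplit : ∀ n ∈ ({21, 27, 32, 49} : Finset ℕ),
      n ∈ ({15, 21, 27} : Finset ℕ) ∨ n = 32 ∨ n = 49 := by decide
  rcases hsplit _ hmem with h | h | h
  · exact isCyclic_degree_not_mem_oddTables φ hφ hv2 hv h
  · exact isogeny_isCyclic_degree_ne_thirtyTwo φ hφ h
  · exact isogeny_isCyclic_degree_ne_fortyNine φ hφ h

/-! ## 8. Assemblies (proved) -/

/-- **PLAN A.** The Frey/odd slice of Lemma 6.8 from Mazur Cor. 4.4 and Klein–Fricke(13) ONLY. -/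
theorem lemma68FreyOdd_of_cor44_of_kleinFricke13 (h44 : Mazur1978.cor44_valuation_j_le_one)
    (h13 : kleinFrickeThirteen_exists_j_eq) : Lemma68FreyOdd := by
  intro a b hab h0 W' _ hiso v hv2 hv
  haveI := isElliptic_freyCurve h0
  obtain ⟨φ, hφ⟩ := radius_at_of_support_of_barrier ({2, 3, 7} : Finset ℕ)
    ({21, 27, 32, 49} : Finset ℕ) (by decide) freyBarrier_covers
    (frey_primeSupport h44 h13 h0 hv2 hv) (frey_barrier_excl hv2 hv) hiso
  exact lemma68At_of_degree_le φ hφ v hv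

/-- The FREY-CLASS RADIUS (feeds `stub_pasten163` as well, via duals): every curve `ℚ`-isogenous to
a Frey curve with an odd multiplicative place is reached from it by an isogeny of degree `≤ 163`. -/
theorem freyRadius_of_cor44_of_kleinFricke13 (h44 : Mazur1978.cor44_valuation_j_le_one)
    (h13 : kleinFrickeThirteen_exists_j_eq) {a b : ℤ} (h0 : a * b * (a + b) ≠ 0)
    {v : HeightOneSpectrum ℤ} (hv2 : Rat.HeightOneSpectrum.natGenerator v ≠ 2)
    (hv : (freyCurve a b).HasMultiplicativeReductionAt v) :
    haveI := isElliptic_freyCurve h0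
    ∀ (W' : WeierstrassCurve ℚ) [W'.IsElliptic], (freyCurve a b).IsIsogenous W' →
      ∃ φ : Isogeny (freyCurve a b) W', φ.degree ≤ 163 := by
  haveI := isElliptic_freyCurve h0
  intro W' _ hiso
  exact radius_at_of_support_of_barrier ({2, 3, 7} : Finset ℕ) ({21, 27, 32, 49} : Finset ℕ)
    (by decide) freyBarrier_covers (frey_primeSupport h44 h13 h0 hv2 hv) (frey_barrier_excl hv2 hv)
    hiso

/-- **PLAN B.** The odd slice for ALL curves: Cor. 4.4 + Klein–Fricke(13) + the three open smooth
levels `65, 125, 169` (the residual of stmt-ABC-18224); the seven prime `j`-tables are NOT needed. -/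
theorem lemma68Odd_of_cor44_of_kleinFricke13_of_threeLevels
    (h44 : Mazur1978.cor44_valuation_j_le_one) (h13 : kleinFrickeThirteen_exists_j_eq)
    (hL3 : ∀ (V V' : WeierstrassCurve ℚ) [V.IsElliptic] [V'.IsElliptic] (ψ : Isogeny V V'),
      ψ.IsCyclic → ψ.degree ∉ ({65, 125, 169} : Finset ℕ)) :
    Lemma68Odd := by
  intro W W' _ _ hiso v hv2 hv
  have hexcl : ∀ (W'' : WeierstrassCurve ℚ) [W''.IsElliptic] (φ : Isogeny W W''), φ.IsCyclic →
      φ.degree ∉ ({15, 20, 21, 26, 27, 32, 35, 49, 65, 125, 169} : Finset ℕ) := by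
    intro W'' _ φ hφ hmem
    have hsplit : ∀ n ∈ ({15, 20, 21, 26, 27, 32, 35, 49, 65, 125, 169} : Finset ℕ),
        n ∈ ({15, 21, 27} : Finset ℕ) ∨ n = 20 ∨ n = 26 ∨ n = 32 ∨ n = 35 ∨ n = 49 ∨
          n ∈ ({65, 125, 169} : Finset ℕ) := by decide
    rcases hsplit _ hmem with h | h | h | h | h | h | h
    · exact isCyclic_degree_not_mem_oddTables φ hφ hv2 hv h
    · exact stub_levelTwenty W W'' φ hφ h
    · exact isCyclic_degree_ne_twentySix h13 W W'' φ hφ h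
    · exact isogeny_isCyclic_degree_ne_thirtyTwo φ hφ h
    · exact isCyclic_degree_ne_thirtyFive W W'' φ hφ h
    · exact isogeny_isCyclic_degree_ne_fortyNine φ hφ h
    · exact hL3 W W'' φ hφ h
  obtain ⟨φ, hφ⟩ := radius_at_of_support_of_barrier ({2, 3, 5, 7, 13} : Finset ℕ)
    ({15, 20, 21, 26, 27, 32, 35, 49, 65, 125, 169} : Finset ℕ) (by decide) oddBarrier_covers
    (fun W'' _ ψ hψ p hp hpd ↦ mem_oddSupport_of_cor44 h44 ψ hψ hv2 hv hp hpd) hexcl hiso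
  exact lemma68At_of_degree_le φ hφ v hv

/-- PLAN C (for the record; k1/k2): the verbatim stub from the radius item `MazurKenkuRadius`. -/
theorem lemma68_of_radius (hRad : Summit.ABC.ABC.Theses.IsogenyGlueCongruence.MazurKenkuRadius) :
    PastenShimura2024_lemma_6_8 := by
  intro W W' _ _ hiso v hv
  obtain ⟨φ, hφ⟩ := hRad W W' hiso
  exact lemma68At_of_degree_le φ hφ v hv

end Summit.ABC.ABC.Cruxes.DefiniteRTControlPrime.StubIdeas3G2

/-! ## 9. RESHAPE CERTIFICATE: the skeleton's consumer accepts the re-cut stub (proved) -/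

namespace Summit.ABC.ABC.Theorems.DefiniteRTControlPrime

open Summit.ABC.ABC.Theses.DefiniteXi
open Literature.NumberTheory.Automorphic
open Summit.ABC.ABC.Cruxes.DefiniteRTControlPrime.StubIdeas3G2

/-- `stub_valTransport` with `PastenShimura2024_lemma_6_8` replaced by `Lemma68FreyOdd`
(body verbatim; the one call of `h68` is at a Frey source and an odd place). -/
theorem valTransport_of_lemma68FreyOdd : Lemma68FreyOdd →
    ∀ (a b : ℤ), IsCoprime a b → a * b * (a + b) ≠ 0 → ∀ q : ℕ, q.Prime → q ≠ 2 →
      q ∣ (freyCurve a b).conductorNorm ℤ →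
      ∀ (W' : WeierstrassCurve ℚ) [W'.IsElliptic], (freyCurve a b).IsIsogenous W' →
        (W'.minimalDiscriminantNorm ℤ).factorization q ≤
          163 * ((freyCurve a b).minimalDiscriminantNorm ℤ).factorization q := by
  intro h68 a b hab h0 q hq hq2 hqN W' _ hiso
  haveI := isElliptic_freyCurve h0
  obtain ⟨v, hv⟩ :
      ∃ v : IsDedekindDomain.HeightOneSpectrum ℤ, Rat.HeightOneSpectrum.natGenerator v = q :=
    ⟨(Rat.HeightOneSpectrum.primesEquiv (R := ℤ)).symm ⟨q, hq⟩,
      Rat.natGenerator_primesEquiv_symm ⟨q, hq⟩⟩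
  have hdvd : (q : ℤ) ∣ a * b * (a + b) :=
    Literature.NumberTheory.DiophantineGeometry.dvd_of_dvd_conductorNorm_freyCurve hab h0 hq hq2 hqN
  have hmult : (freyCurve a b).HasMultiplicativeReductionAt v :=
    Literature.NumberTheory.DiophantineGeometry.hasMultiplicativeReductionAt_freyCurve_of_ne_two
      hab h0 v (hv ▸ hq2) (hv ▸ hdvd)
  obtain ⟨m, n, hm0, -, -, hn, hmn⟩ := h68 a b hab h0 W' hiso v (hv ▸ hq2) hmult
  have h1 := factorization_minimalDiscriminantNorm_holds (freyCurve a b) v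
  have h2 := factorization_minimalDiscriminantNorm_holds W' v
  rw [hv] at h1 h2
  rw [h1, h2]
  calc W'.ordMinimalDiscriminant v
      ≤ W'.ordMinimalDiscriminant v * m := Nat.le_mul_of_pos_right _ hm0
    _ = (freyCurve a b).ordMinimalDiscriminant v * n := hmn.symm
    _ ≤ (freyCurve a b).ordMinimalDiscriminant v * 163 := Nat.mul_le_mul_left _ hn
    _ = 163 * (freyCurve a b).ordMinimalDiscriminant v := Nat.mul_comm _ _

end Summit.ABC.ABC.Theorems.DefiniteRTControlPrime

end
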